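import Mathlib

/-!
# `NoFoldBound`, line Ideator3Sketch — the three-class inequality (depth-2 stratum algebra)

Crux `NoFoldBound` (stmt-CriticalPhenomena-8296), route `SAWDevelopingMap`, lead seat c3, skeleton v6
(`stub_collarCoherence`). At a depth-2 vertex (a neighbour touches the complement) the first arrivals
occupy three CONSECUTIVE rigid winding classes (`helper_depthTwoClasses`), one per port, so the dressed
port sums are real nonnegative masses `s_j` (sum mode) and `b_j` (Beltrami mode) times a common unit
phase, with relative phases `e^{±5πi/12}` (sum mode) and `e^{±13πi/12}` (Beltrami mode) between the
middle class and its two neighbours (cf. the two-class case `helper_twoClassBound`,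
`sealed_core`). The slit source law and `SourceLoopBound` give the dressing bounds
`ρ s_j ≤ b_j ≤ r s_j` (`ρ = β_T/α_T`, `r = r(c) < 1`). This file proves the finite-dimensional fact
that then decides the stratum:

* `three_class_normSq_eq` — `‖m + p e^{iφ} + q e^{-iφ}‖² = (m + (p+q) cos φ)² + ((p−q) sin φ)²`;
* `three_class_bound` — under the dressing bounds and the MIDDLE-PORT BALANCE hypothesis
  `cos(π/12)·r·(s₁+s₂) − ρ·s₀ ≤ k₁ (s₀ + sin(π/12)(s₁+s₂))` (with `r ≤ k₁`, `k₁² + (r−ρ')²/2 ≤ k²`),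
  `‖b₀ + b₁ e^{13πi/12} + b₂ e^{-13πi/12}‖ ≤ k ‖s₀ + s₁ e^{5πi/12} + s₂ e^{-5πi/12}‖`.

So at depth 2 a fold needs middle-port starvation: with `r = r(0.13) = 0.727`, `ρ = 0.614`, `k₁ = 0.95`
the balance hypothesis reads `s₀ ≥ 0.29 (s₁ + s₂)` on the dressed masses. Pure real/complex algebra;
nothing about walks is used or asserted. [folklore]
-/

noncomputable section

namespace Summit.CriticalPhenomena.SAWScalingLimit.Theorems.SAWDevelopingMapNoFoldBound

open Complex

/-- `‖m + p e^{iφ} + q e^{-iφ}‖² = (m + (p + q) cos φ)² + ((p − q) sin φ)²` for real `m p q φ`. -/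
theorem three_class_normSq_eq (m p q φ : ℝ) :
    ‖(m : ℂ) + p * Complex.exp (φ * Complex.I) + q * Complex.exp (-(φ * Complex.I))‖ ^ 2 =
      (m + (p + q) * Real.cos φ) ^ 2 + ((p - q) * Real.sin φ) ^ 2 := by
  have h1 : Complex.exp (φ * Complex.I) = Real.cos φ + Real.sin φ * Complex.I := by
    rw [Complex.exp_mul_I, ← Complex.ofReal_cos, ← Complex.ofReal_sin]
  have h2 : Complex.exp (-(φ * Complex.I)) = Real.cos φ - Real.sin φ * Complex.I := by
    rw [show -(φ * Complex.I : ℂ) = ((-φ : ℝ) : ℂ) * Complex.I by push_cast; ring, Complex.exp_mul_I,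
      ← Complex.ofReal_cos, ← Complex.ofReal_sin, Real.cos_neg, Real.sin_neg]
    push_cast; ring
  rw [h1, h2, Complex.sq_norm, Complex.normSq_apply]
  simp only [add_re, add_im, mul_re, mul_im, ofReal_re, ofReal_im, I_re, I_im, sub_re, sub_im]
  ring

/-- `cos (13π/12) = −cos (π/12)`. -/
theorem cos_thirteen_pi_div_twelve : Real.cos (13 * Real.pi / 12) = -Real.cos (Real.pi / 12) := by
  rw [show 13 * Real.pi / 12 = Real.pi / 12 + Real.pi by ring, Real.cos_add_pi]

/-- `sin (13π/12) = −sin (π/12)`. -/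
theorem sin_thirteen_pi_div_twelve : Real.sin (13 * Real.pi / 12) = -Real.sin (Real.pi / 12) := by
  rw [show 13 * Real.pi / 12 = Real.pi / 12 + Real.pi by ring, Real.sin_add_pi]

/-- `cos (5π/12) = sin (π/12)`. -/
theorem cos_five_pi_div_twelve : Real.cos (5 * Real.pi / 12) = Real.sin (Real.pi / 12) := by
  rw [show 5 * Real.pi / 12 = Real.pi / 2 - Real.pi / 12 by ring, Real.cos_pi_div_two_sub]

/-- `sin (5π/12) = cos (π/12)`. -/
theorem sin_five_pi_div_twelve : Real.sin (5 * Real.pi / 12) = Real.cos (Real.pi / 12) := by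
  rw [show 5 * Real.pi / 12 = Real.pi / 2 - Real.pi / 12 by ring, Real.sin_pi_div_two_sub]

/-- `sin² (π/12) ≤ 1/4` (indeed `sin (π/12) = (√6 − √2)/4 ≈ 0.2588 ≤ sin (π/6) = 1/2`). -/
theorem sin_sq_pi_div_twelve_le : Real.sin (Real.pi / 12) ^ 2 ≤ 1 / 4 := by
  have h0 : 0 ≤ Real.sin (Real.pi / 12) :=
    Real.sin_nonneg_of_nonneg_of_le_pi (by positivity) (by linarith [Real.pi_pos])
  have h1 : Real.sin (Real.pi / 12) ≤ 1 / 2 := by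
    rw [← Real.sin_pi_div_six]
    exact Real.sin_le_sin_of_le_of_le_pi_div_two (by linarith [Real.pi_pos])
      (by linarith [Real.pi_pos]) (by linarith [Real.pi_pos])
  nlinarith

/-- The real-arithmetic core of `three_class_bound`, with `C = cos(π/12)`, `σ = sin(π/12)` abstracted
to reals with `0 ≤ C`, `0 ≤ σ`, `C² + σ² = 1`, `σ² ≤ 1/4`. -/
theorem three_class_core {s₀ s₁ s₂ b₀ b₁ b₂ ρ ρ' r k₁ k C σ : ℝ}
    (hs₀ : 0 ≤ s₀) (hs₁ : 0 ≤ s₁) (hs₂ : 0 ≤ s₂) (hρ' : 0 ≤ ρ') (hρ'r : ρ' ≤ r)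
    (hrk : r ≤ k₁) (hk : k₁ ^ 2 + (r - ρ') ^ 2 / 2 ≤ k ^ 2)
    (hb₀l : ρ * s₀ ≤ b₀) (hb₀u : b₀ ≤ r * s₀)
    (hb₁l : ρ' * s₁ ≤ b₁) (hb₁u : b₁ ≤ r * s₁) (hb₂l : ρ' * s₂ ≤ b₂) (hb₂u : b₂ ≤ r * s₂)
    (hC0 : 0 ≤ C) (hσ0 : 0 ≤ σ) (hCσ : C ^ 2 + σ ^ 2 = 1) (hσ2 : σ ^ 2 ≤ 1 / 4)
    (hbal : C * r * (s₁ + s₂) - ρ * s₀ ≤ k₁ * (s₀ + σ * (s₁ + s₂))) :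
    (b₀ - (b₁ + b₂) * C) ^ 2 + ((b₁ - b₂) * σ) ^ 2 ≤
      k ^ 2 * ((s₀ + (s₁ + s₂) * σ) ^ 2 + ((s₁ - s₂) * C) ^ 2) := by
  have hr0 : 0 ≤ r := hρ'.trans hρ'r
  have hk₁0 : 0 ≤ k₁ := hr0.trans hrk
  have hSig0 : 0 ≤ (s₁ + s₂) * σ := by positivity
  have hS0 : 0 ≤ s₀ + (s₁ + s₂) * σ := by positivity
  have hC2 : 3 / 4 ≤ C ^ 2 := by linarith
  set S := s₀ + (s₁ + s₂) * σ with hSdef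
  -- real part: `(b₀ - (b₁+b₂)C)² ≤ k₁² S²`
  have hre : (b₀ - (b₁ + b₂) * C) ^ 2 ≤ k₁ ^ 2 * S ^ 2 := by
    have hup : (b₁ + b₂) * C ≤ C * r * (s₁ + s₂) := by
      have := mul_le_mul_of_nonneg_right (add_le_add hb₁u hb₂u) hC0
      linarith [this]
    have hbC : 0 ≤ (b₁ + b₂) * C := by
      have hb1 : 0 ≤ b₁ := (mul_nonneg hρ' hs₁).trans hb₁l
      have hb2 : 0 ≤ b₂ := (mul_nonneg hρ' hs₂).trans hb₂l
      positivity
    have habs : |b₀ - (b₁ + b₂) * C| ≤ k₁ * S := by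
      rw [abs_le]
      constructor
      · -- fold regime: balance hypothesis
        have : k₁ * (s₀ + σ * (s₁ + s₂)) = k₁ * S := by rw [hSdef]; ring
        linarith [hbal, hb₀l, hup, this]
      · -- `b₀ ≤ r s₀ ≤ k₁ s₀ ≤ k₁ S`
        have h1 : b₀ ≤ k₁ * s₀ := hb₀u.trans (mul_le_mul_of_nonneg_right hrk hs₀)
        have h2 : k₁ * s₀ ≤ k₁ * S := mul_le_mul_of_nonneg_left (by linarith) hk₁0
        linarith
    calc (b₀ - (b₁ + b₂) * C) ^ 2 = |b₀ - (b₁ + b₂) * C| ^ 2 := (sq_abs _).symm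
      _ ≤ (k₁ * S) ^ 2 := pow_le_pow_left₀ (abs_nonneg _) habs 2
      _ = k₁ ^ 2 * S ^ 2 := by ring
  -- imaginary part: `|b₁ - b₂| ≤ r|s₁ - s₂| + (r - ρ')(s₁+s₂)/2`
  have hd : |b₁ - b₂| ≤ r * |s₁ - s₂| + (r - ρ') * ((s₁ + s₂) / 2) := by
    rcases le_total s₁ s₂ with h12 | h12
    · have hp : 0 ≤ (r - ρ') * (s₂ - s₁) := mul_nonneg (sub_nonneg.2 hρ'r) (sub_nonneg.2 h12)
      have hq : 0 ≤ (3 * r + ρ') * (s₂ - s₁) := mul_nonneg (by linarith) (sub_nonneg.2 h12)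
      rw [abs_of_nonpos (sub_nonpos.2 h12), abs_le]
      constructor
      · linarith [hb₁l, hb₂u, hp]
      · linarith [hb₁u, hb₂l, hq]
    · have hp : 0 ≤ (r - ρ') * (s₁ - s₂) := mul_nonneg (sub_nonneg.2 hρ'r) (sub_nonneg.2 h12)
      have hq : 0 ≤ (3 * r + ρ') * (s₁ - s₂) := mul_nonneg (by linarith) (sub_nonneg.2 h12)
      rw [abs_of_nonneg (sub_nonneg.2 h12), abs_le]
      constructor
      · linarith [hb₁l, hb₂u, hq]
      · linarith [hb₁u, hb₂l, hp]
  have hA0 : 0 ≤ r * |s₁ - s₂| := mul_nonneg hr0 (abs_nonneg _)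
  have hB0 : 0 ≤ (r - ρ') * ((s₁ + s₂) / 2) := mul_nonneg (by linarith) (by linarith)
  have hd2 : (b₁ - b₂) ^ 2 ≤ 2 * (r ^ 2 * (s₁ - s₂) ^ 2) + 2 * ((r - ρ') ^ 2 * ((s₁ + s₂) / 2) ^ 2) := by
    have e1 : (b₁ - b₂) ^ 2 = |b₁ - b₂| ^ 2 := (sq_abs _).symm
    have e2 : (s₁ - s₂) ^ 2 = |s₁ - s₂| ^ 2 := (sq_abs _).symm
    have h1 : |b₁ - b₂| ^ 2 ≤ (r * |s₁ - s₂| + (r - ρ') * ((s₁ + s₂) / 2)) ^ 2 :=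
      pow_le_pow_left₀ (abs_nonneg _) hd 2
    have h2 : (r * |s₁ - s₂| + (r - ρ') * ((s₁ + s₂) / 2)) ^ 2 ≤
        2 * (r * |s₁ - s₂|) ^ 2 + 2 * ((r - ρ') * ((s₁ + s₂) / 2)) ^ 2 := by
      nlinarith [sq_nonneg (r * |s₁ - s₂| - (r - ρ') * ((s₁ + s₂) / 2))]
    rw [e1, e2]
    calc |b₁ - b₂| ^ 2 ≤ _ := h1
      _ ≤ _ := h2
      _ = 2 * (r ^ 2 * |s₁ - s₂| ^ 2) + 2 * ((r - ρ') ^ 2 * ((s₁ + s₂) / 2) ^ 2) := by ring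
  -- the two pieces of the imaginary part
  have t1 : 2 * (r ^ 2 * (s₁ - s₂) ^ 2) * σ ^ 2 ≤ k ^ 2 * ((s₁ - s₂) * C) ^ 2 := by
    have hrk' : r ≤ k₁ := hrk
    have hr2 : r ^ 2 ≤ k₁ ^ 2 := pow_le_pow_left₀ hr0 hrk' 2
    have hrk2 : r ^ 2 ≤ k ^ 2 := by linarith [hr2, hk, sq_nonneg (r - ρ')]
    have hD2 : 0 ≤ (s₁ - s₂) ^ 2 := sq_nonneg _
    have step : 2 * r ^ 2 * σ ^ 2 ≤ k ^ 2 * C ^ 2 := by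
      have a1 : 2 * r ^ 2 * σ ^ 2 ≤ 2 * r ^ 2 * (1 / 4) :=
        mul_le_mul_of_nonneg_left hσ2 (by positivity)
      have a2 : k ^ 2 * (3 / 4) ≤ k ^ 2 * C ^ 2 := mul_le_mul_of_nonneg_left hC2 (sq_nonneg _)
      linarith [a1, a2, hrk2, sq_nonneg k, sq_nonneg r]
    calc 2 * (r ^ 2 * (s₁ - s₂) ^ 2) * σ ^ 2 = (2 * r ^ 2 * σ ^ 2) * (s₁ - s₂) ^ 2 := by ring
      _ ≤ (k ^ 2 * C ^ 2) * (s₁ - s₂) ^ 2 := mul_le_mul_of_nonneg_right step hD2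
      _ = k ^ 2 * ((s₁ - s₂) * C) ^ 2 := by ring
  have t2 : 2 * ((r - ρ') ^ 2 * ((s₁ + s₂) / 2) ^ 2) * σ ^ 2 ≤ ((r - ρ') ^ 2 / 2) * S ^ 2 := by
    have h1 : ((s₁ + s₂) * σ) ^ 2 ≤ S ^ 2 := pow_le_pow_left₀ hSig0 (by rw [hSdef]; linarith) 2
    calc 2 * ((r - ρ') ^ 2 * ((s₁ + s₂) / 2) ^ 2) * σ ^ 2
        = ((r - ρ') ^ 2 / 2) * ((s₁ + s₂) * σ) ^ 2 := by ring
      _ ≤ ((r - ρ') ^ 2 / 2) * S ^ 2 := mul_le_mul_of_nonneg_left h1 (by positivity)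
  have him : ((b₁ - b₂) * σ) ^ 2 ≤ k ^ 2 * ((s₁ - s₂) * C) ^ 2 + ((r - ρ') ^ 2 / 2) * S ^ 2 := by
    have hσsq : 0 ≤ σ ^ 2 := sq_nonneg _
    calc ((b₁ - b₂) * σ) ^ 2 = (b₁ - b₂) ^ 2 * σ ^ 2 := by ring
      _ ≤ (2 * (r ^ 2 * (s₁ - s₂) ^ 2) + 2 * ((r - ρ') ^ 2 * ((s₁ + s₂) / 2) ^ 2)) * σ ^ 2 :=
          mul_le_mul_of_nonneg_right hd2 hσsq
      _ = 2 * (r ^ 2 * (s₁ - s₂) ^ 2) * σ ^ 2 +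
            2 * ((r - ρ') ^ 2 * ((s₁ + s₂) / 2) ^ 2) * σ ^ 2 := by ring
      _ ≤ _ := add_le_add t1 t2
  -- assemble
  have hS2 : 0 ≤ S ^ 2 := sq_nonneg _
  have hfin : (k₁ ^ 2 + (r - ρ') ^ 2 / 2) * S ^ 2 ≤ k ^ 2 * S ^ 2 := mul_le_mul_of_nonneg_right hk hS2
  calc (b₀ - (b₁ + b₂) * C) ^ 2 + ((b₁ - b₂) * σ) ^ 2
      ≤ k₁ ^ 2 * S ^ 2 + (k ^ 2 * ((s₁ - s₂) * C) ^ 2 + ((r - ρ') ^ 2 / 2) * S ^ 2) :=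
        add_le_add hre him
    _ = (k₁ ^ 2 + (r - ρ') ^ 2 / 2) * S ^ 2 + k ^ 2 * ((s₁ - s₂) * C) ^ 2 := by ring
    _ ≤ k ^ 2 * S ^ 2 + k ^ 2 * ((s₁ - s₂) * C) ^ 2 := by linarith
    _ = k ^ 2 * (S ^ 2 + ((s₁ - s₂) * C) ^ 2) := by ring

/-- **The three-class inequality (depth-2 stratum).** Real nonnegative dressed masses: middle class
`s₀, b₀`, neighbouring classes `s₁, b₁` and `s₂, b₂`, with dressing bounds `ρ s₀ ≤ b₀ ≤ r s₀`,
`ρ' s_j ≤ b_j ≤ r s_j` (`j = 1, 2`), constants `0 ≤ ρ' ≤ r ≤ k₁`, `k₁² + (r − ρ')²/2 ≤ k²`, `0 ≤ k`,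
and the MIDDLE-PORT BALANCE hypothesis
`cos(π/12) r (s₁ + s₂) − ρ s₀ ≤ k₁ (s₀ + sin(π/12) (s₁ + s₂))`. Then the Beltrami superposition is at
most `k` times the sum superposition:
`‖b₀ + b₁ e^{13πi/12} + b₂ e^{−13πi/12}‖ ≤ k ‖s₀ + s₁ e^{5πi/12} + s₂ e^{−5πi/12}‖`.
Proof: by `three_class_normSq_eq` the squares are `(b₀ − C(b₁+b₂))² + σ²(b₁−b₂)²` and
`(s₀ + σ(s₁+s₂))² + C²(s₁−s₂)²` (`C = cos(π/12)`, `σ = sin(π/12)`, `σ² ≤ 1/4`), and `three_class_core`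
compares them (real part: balance if `b₀ ≤ C(b₁+b₂)`, else `b₀ ≤ r s₀`; imaginary part:
`|b₁ − b₂| ≤ r|s₁ − s₂| + (r − ρ')(s₁ + s₂)/2`). [folklore] -/
theorem three_class_bound {s₀ s₁ s₂ b₀ b₁ b₂ ρ ρ' r k₁ k : ℝ}
    (hs₀ : 0 ≤ s₀) (hs₁ : 0 ≤ s₁) (hs₂ : 0 ≤ s₂) (hρ' : 0 ≤ ρ') (hρ'r : ρ' ≤ r)
    (hrk : r ≤ k₁) (hk : k₁ ^ 2 + (r - ρ') ^ 2 / 2 ≤ k ^ 2) (hk0 : 0 ≤ k)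
    (hb₀l : ρ * s₀ ≤ b₀) (hb₀u : b₀ ≤ r * s₀)
    (hb₁l : ρ' * s₁ ≤ b₁) (hb₁u : b₁ ≤ r * s₁) (hb₂l : ρ' * s₂ ≤ b₂) (hb₂u : b₂ ≤ r * s₂)
    (hbal : Real.cos (Real.pi / 12) * r * (s₁ + s₂) - ρ * s₀ ≤
      k₁ * (s₀ + Real.sin (Real.pi / 12) * (s₁ + s₂))) :
    ‖(b₀ : ℂ) + b₁ * Complex.exp ((13 * Real.pi / 12 : ℝ) * Complex.I) +
        b₂ * Complex.exp (-((13 * Real.pi / 12 : ℝ) * Complex.I))‖ ≤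
      k * ‖(s₀ : ℂ) + s₁ * Complex.exp ((5 * Real.pi / 12 : ℝ) * Complex.I) +
        s₂ * Complex.exp (-((5 * Real.pi / 12 : ℝ) * Complex.I))‖ := by
  have hC0 : 0 ≤ Real.cos (Real.pi / 12) :=
    Real.cos_nonneg_of_mem_Icc ⟨by linarith [Real.pi_pos], by linarith [Real.pi_pos]⟩
  have hσ0 : 0 ≤ Real.sin (Real.pi / 12) :=
    Real.sin_nonneg_of_nonneg_of_le_pi (by positivity) (by linarith [Real.pi_pos])
  have hCσ : Real.cos (Real.pi / 12) ^ 2 + Real.sin (Real.pi / 12) ^ 2 = 1 := Real.cos_sq_add_sin_sq _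
  have eB : ‖(b₀ : ℂ) + b₁ * Complex.exp ((13 * Real.pi / 12 : ℝ) * Complex.I) +
        b₂ * Complex.exp (-((13 * Real.pi / 12 : ℝ) * Complex.I))‖ ^ 2 =
      (b₀ - (b₁ + b₂) * Real.cos (Real.pi / 12)) ^ 2 + ((b₁ - b₂) * Real.sin (Real.pi / 12)) ^ 2 := by
    rw [three_class_normSq_eq, cos_thirteen_pi_div_twelve, sin_thirteen_pi_div_twelve]; ring
  have eS : ‖(s₀ : ℂ) + s₁ * Complex.exp ((5 * Real.pi / 12 : ℝ) * Complex.I) +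
        s₂ * Complex.exp (-((5 * Real.pi / 12 : ℝ) * Complex.I))‖ ^ 2 =
      (s₀ + (s₁ + s₂) * Real.sin (Real.pi / 12)) ^ 2 + ((s₁ - s₂) * Real.cos (Real.pi / 12)) ^ 2 := by
    rw [three_class_normSq_eq, cos_five_pi_div_twelve, sin_five_pi_div_twelve]
  rw [← abs_of_nonneg (norm_nonneg _), ← abs_of_nonneg (mul_nonneg hk0 (norm_nonneg _)), ← sq_le_sq,
    mul_pow, eB, eS]
  exact three_class_core hs₀ hs₁ hs₂ hρ' hρ'r hrk hk hb₀l hb₀u hb₁l hb₁u hb₂l hb₂u hC0 hσ0 hCσ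
    sin_sq_pi_div_twelve_le hbal

end Summit.CriticalPhenomena.SAWScalingLimit.Theorems.SAWDevelopingMapNoFoldBound
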